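import Summits.CriticalPhenomena.PercolationContinuityZ3.Theorems.PercNearOneGluingAdditiveGluingLinearCert
import Summits.CriticalPhenomena.PercolationContinuityZ3.Theorems.PercNearOneGluingAdditiveGluingFingerML3Reductions
import HarnessLib

/-! # Crux `PercNearOneGluing.AdditiveGluing` (stmt-CriticalPhenomena-4576) — `stub_fingerML3_vp` from the FINGER-DELETION step FQ♯
# (the surviving universal step of the linear-certificate route; seat (b) V⁺-form, `png-dp-vplus`, gen 8)

Support file (`--supports stmt-CriticalPhenomena-4576`); no definitions, no named facts, no sorries.  Companion of
`…AdditiveGluingLinearCert.lean` (`linearCert_split_step`, `fingerML3_of_linearCert`; gen 7).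

Setting (K-world set form of the stub): weighting `K` on `Fin n`, relays `A ∋ b, d`, block `N` disjoint from `A`, no pairs `N–b`;
for a set `D ⊆ N` of DELETED fingers `K_D` = `K` with every pair `D–A` killed; the ACTIVE CONTACTS of stage `D` are the relays `a ≠ b` with a
positive pair to some finger outside `D`; `slack_D(a) = μ_{K_D}(a↔b) − μ_{K_D}(d↔b)`; `M = {d↮N}`, `U = ⋃_{v∈N}{v↔b}`, `R_F` = "some pair of
`F` open", `Δ_w(F) = μ_w(R_F ∩ M ∩ U) − μ_w(R_F ∩ M ∩ {d↔b})` (the set-form margin).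

**FQ♯ at stage `D` for a finger `f ∉ D`** (memo MEMO-gen7 §0(2); `F_f` = the pairs `f–A`, `ψ_f = μ_{K_D}(R_{F_f}ᶜ)`, `h` = the minimal
active slack of stage `D`, `h'` = the minimal active slack of stage `D ∪ {f}` (or `h' = h` if that stage has no active contact)):
  `Δ_{K_D}(F_f) − μ_{K_D}(R_{F_f})·h ≥ ψ_f · max(0, h − h')`.
ttrl2 census (run/shared/lean/ttrl/setG/QSHARP.md, 509 M exact instances): FQ♯ holds with 0 violations in 243.9 M designations at fingers NOT
wired to `b`, and in the "∃ finger" form (181.9 M instances); it FAILS only at fingers wired to `b` (53 designations) — whence the no-`N–b`-pair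
setting here; the contact-deletion analogue Q♯ is false even at a unique weakest contact (342 instances).

* `fingerML3_of_FQsharp` — **if at every stage `D ⊊ N` with an active contact SOME active finger `f ∉ D` satisfies FQ♯, then the conclusion
  of `stub_fingerML3_vp` holds** (under the stub's hypothesis `μ_K(d↔b) ≤ μ_K(a↔b)`, `a ∈ A`).  Proof: reverse induction on `D` proves the
  linear certificate (L2) `Δ_{K_D}(F_N) ≥ μ_{K_D}(R_{F_N})·h` for every `h` below the active slacks of stage `D` (`linearCert_split_step` with
  `F₁ = F_f`, the killed weighting `pinW K_D F_f ∅` being `K_{D∪{f}}`; at a stage without active contacts `R` is null); at `D = ∅` the stub's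
  hypothesis makes `h = 0` admissible, and `fingerML3_of_setForm` concludes.
So the registered stub is reduced to ONE hypothesis-free inequality per (sub-)system and finger — the form in which the remaining work on
conjecture G is now stated. [cite: KozmaNitzan2024, Thm 4 and Lemma 5 (§3.2, pp. 12–14), §4 p. 20 (conditioning on the pattern of a pair set)]
-/

namespace Summit.CriticalPhenomena.PercolationContinuityZ3.Theorems

open MeasureTheory Set
open Literature.Probability.LatticeModels (prodBernoulli)
open Literature.Probability.Percolation (BondConfig openConn openGraph pinW)

noncomputable section
open Classical

section FQsharpReduction

open Literature.Probability.LatticeModels Literature.Probability.Percolation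

variable {n : ℕ}

/-- Killing the pairs `f–A` in the stage-`D` weighting gives the stage-`D ∪ {f}` weighting. [folklore] -/
theorem killStage_pinW_eq (K : Sym2 (Fin n) → unitInterval) (A D : Finset (Fin n)) (f : Fin n) :
    pinW (fun e' : Sym2 (Fin n) => if (∃ v ∈ D, ∃ a ∈ A, e' = s(v, a)) then (0 : unitInterval) else K e')
        (↑(A.image (fun a : Fin n => s(f, a))) : Set (Sym2 (Fin n))) (∅ : Set (Sym2 (Fin n))) =
      fun e' : Sym2 (Fin n) => if (∃ v ∈ insert f D, ∃ a ∈ A, e' = s(v, a)) then (0 : unitInterval) else K e' := by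
  funext e
  by_cases he : e ∈ (↑(A.image (fun a : Fin n => s(f, a))) : Set (Sym2 (Fin n)))
  · rw [pinW_apply_of_mem_of_not_mem _ he (Set.notMem_empty e)]
    obtain ⟨a, ha, rfl⟩ := Finset.mem_image.1 (Finset.mem_coe.1 he)
    have h1 : ∃ v ∈ insert f D, ∃ a' ∈ A, s(f, a) = s(v, a') := ⟨f, Finset.mem_insert_self f D, a, ha, rfl⟩
    simp only [h1, if_true]
  · rw [pinW_apply_of_not_mem _ _ he]
    by_cases h2 : ∃ v ∈ D, ∃ a ∈ A, e = s(v, a)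
    · have h3 : ∃ v ∈ insert f D, ∃ a ∈ A, e = s(v, a) := by
        obtain ⟨v, hv, a, ha, h⟩ := h2
        exact ⟨v, Finset.mem_insert_of_mem hv, a, ha, h⟩
      simp only [h2, h3, if_true]
    · have h3 : ¬ ∃ v ∈ insert f D, ∃ a ∈ A, e = s(v, a) := by
        rintro ⟨v, hv, a, ha, h⟩
        rcases Finset.mem_insert.1 hv with rfl | hv
        · exact he (Finset.mem_coe.2 (Finset.mem_image.2 ⟨a, ha, h.symm⟩))
        · exact h2 ⟨v, hv, a, ha, h⟩
      simp only [h2, h3, if_false]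

/-- **`stub_fingerML3_vp` from the finger-deletion steps FQ♯.**  Stub setting (`Disjoint N A`, no pairs `N–b`,
`μ_K(d↔b) ≤ μ_K(a↔b)` on `A`).  Hypothesis (FQ♯, "∃ finger" form, see the module doc-string): for every set `D ⊆ N` of deleted fingers
such that stage `D` has an active contact, some active finger `f ∉ D` satisfies, for all reals `h ≤` every active slack of stage `D` and
`h'` = the least active slack of stage `D ∪ {f}` (or `h' = h` if there is none),
`Δ_{K_D}(F_f) − μ_{K_D}(R_{F_f})·h ≥ μ_{K_D}(R_{F_f}ᶜ)·max(0, h − h')`.  Then `μ_{K/N}(R ∩ {d↔b}) ≤ μ_{K/N}(R ∩ ⋃_{v∈N}{v↔b})`.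
[cite: KozmaNitzan2024, Thm 4 (§3.2, pp. 12–14), §4 p. 20] -/
theorem fingerML3_of_FQsharp (K : Sym2 (Fin n) → unitInterval) (A N : Finset (Fin n)) (d b : Fin n)
    (hNA : Disjoint N A)
    (hnb : ∀ v ∈ N, (K s(v, b) : ℝ) = 0)
    (hle : ∀ a ∈ A, (prodBernoulli K).real (openConn d b) ≤ (prodBernoulli K).real (openConn a b))
    (HFQ : ∀ D : Finset (Fin n), D ⊆ N →
      (∃ a ∈ A, a ≠ b ∧ ∃ v ∈ N, v ∉ D ∧ (K s(v, a) : ℝ) ≠ 0) →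
      ∃ f ∈ N, f ∉ D ∧ (∃ a ∈ A, a ≠ b ∧ (K s(f, a) : ℝ) ≠ 0) ∧
        ∀ h h' : ℝ,
          (∀ a ∈ A, a ≠ b → (∃ v ∈ N, v ∉ D ∧ (K s(v, a) : ℝ) ≠ 0) →
            h ≤ (prodBernoulli (fun e' : Sym2 (Fin n) => if (∃ v ∈ D, ∃ a' ∈ A, e' = s(v, a')) then (0 : unitInterval) else K e')).real
                    (openConn a b) -
                  (prodBernoulli (fun e' : Sym2 (Fin n) => if (∃ v ∈ D, ∃ a' ∈ A, e' = s(v, a')) then (0 : unitInterval) else K e')).real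
                    (openConn d b)) →
          ((∀ a ∈ A, a ≠ b → (∃ v ∈ N, v ∉ insert f D ∧ (K s(v, a) : ℝ) ≠ 0) →
              h' ≤ (prodBernoulli (fun e' : Sym2 (Fin n) =>
                        if (∃ v ∈ insert f D, ∃ a' ∈ A, e' = s(v, a')) then (0 : unitInterval) else K e')).real (openConn a b) -
                    (prodBernoulli (fun e' : Sym2 (Fin n) =>
                        if (∃ v ∈ insert f D, ∃ a' ∈ A, e' = s(v, a')) then (0 : unitInterval) else K e')).real (openConn d b)) ∧
            ((∃ a ∈ A, a ≠ b ∧ (∃ v ∈ N, v ∉ insert f D ∧ (K s(v, a) : ℝ) ≠ 0) ∧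
                h' = (prodBernoulli (fun e' : Sym2 (Fin n) =>
                        if (∃ v ∈ insert f D, ∃ a' ∈ A, e' = s(v, a')) then (0 : unitInterval) else K e')).real (openConn a b) -
                    (prodBernoulli (fun e' : Sym2 (Fin n) =>
                        if (∃ v ∈ insert f D, ∃ a' ∈ A, e' = s(v, a')) then (0 : unitInterval) else K e')).real (openConn d b)) ∨
              ((¬ ∃ a ∈ A, a ≠ b ∧ ∃ v ∈ N, v ∉ insert f D ∧ (K s(v, a) : ℝ) ≠ 0) ∧ h' = h))) →
          (prodBernoulli (fun e' : Sym2 (Fin n) => if (∃ v ∈ D, ∃ a' ∈ A, e' = s(v, a')) then (0 : unitInterval) else K e')).real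
                ({ω : Set (Sym2 (Fin n)) | ∃ e ∈ A.image (fun a : Fin n => s(f, a)), e ∈ ω} ∩
                  ({ω : BondConfig (Fin n) | ∀ x ∈ (↑N : Set (Fin n)), ¬ (openGraph ω).Reachable d x} ∩ ⋃ v ∈ N, openConn v b)) -
              (prodBernoulli (fun e' : Sym2 (Fin n) => if (∃ v ∈ D, ∃ a' ∈ A, e' = s(v, a')) then (0 : unitInterval) else K e')).real
                ({ω : Set (Sym2 (Fin n)) | ∃ e ∈ A.image (fun a : Fin n => s(f, a)), e ∈ ω} ∩
                  ({ω : BondConfig (Fin n) | ∀ x ∈ (↑N : Set (Fin n)), ¬ (openGraph ω).Reachable d x} ∩ openConn d b)) -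
              (prodBernoulli (fun e' : Sym2 (Fin n) => if (∃ v ∈ D, ∃ a' ∈ A, e' = s(v, a')) then (0 : unitInterval) else K e')).real
                {ω : Set (Sym2 (Fin n)) | ∃ e ∈ A.image (fun a : Fin n => s(f, a)), e ∈ ω} * h ≥
            (prodBernoulli (fun e' : Sym2 (Fin n) => if (∃ v ∈ D, ∃ a' ∈ A, e' = s(v, a')) then (0 : unitInterval) else K e')).real
                ({ω : Set (Sym2 (Fin n)) | ∃ e ∈ A.image (fun a : Fin n => s(f, a)), e ∈ ω}ᶜ : Set (BondConfig (Fin n))) *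
              max 0 (h - h')) :
    (prodBernoulli (fun e' : Sym2 (Fin n) => if (∀ y ∈ e', y ∈ N) ∧ ¬ e'.IsDiag then 1 else K e')).real
        ({ω : Set (Sym2 (Fin n)) | ∃ v ∈ N, ∃ a ∈ A, s(v, a) ∈ ω} ∩ openConn d b) ≤
      (prodBernoulli (fun e' : Sym2 (Fin n) => if (∀ y ∈ e', y ∈ N) ∧ ¬ e'.IsDiag then 1 else K e')).real
        ({ω : Set (Sym2 (Fin n)) | ∃ v ∈ N, ∃ a ∈ A, s(v, a) ∈ ω} ∩ ⋃ v ∈ N, openConn v b) := by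
  -- notation
  set MU : Set (BondConfig (Fin n)) :=
    {ω : BondConfig (Fin n) | ∀ x ∈ (↑N : Set (Fin n)), ¬ (openGraph ω).Reachable d x} ∩ ⋃ v ∈ N, openConn v b with hMU
  set MX : Set (BondConfig (Fin n)) :=
    {ω : BondConfig (Fin n) | ∀ x ∈ (↑N : Set (Fin n)), ¬ (openGraph ω).Reachable d x} ∩ openConn d b with hMX
  set Fall : Finset (Sym2 (Fin n)) := (N ×ˢ A).image (fun va : Fin n × Fin n => s(va.1, va.2)) with hFall
  -- stage weightings and activity
  let KD : Finset (Fin n) → Sym2 (Fin n) → unitInterval := fun D e' =>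
    if (∃ v ∈ D, ∃ a' ∈ A, e' = s(v, a')) then (0 : unitInterval) else K e'
  let Act : Finset (Fin n) → Fin n → Prop := fun D a => a ∈ A ∧ a ≠ b ∧ ∃ v ∈ N, v ∉ D ∧ (K s(v, a) : ℝ) ≠ 0
  let slack : Finset (Fin n) → Fin n → ℝ := fun D a =>
    (prodBernoulli (KD D)).real (openConn a b) - (prodBernoulli (KD D)).real (openConn d b)
  -- the main claim: the linear certificate at every stage
  have main : ∀ (m : ℕ) (D : Finset (Fin n)), D ⊆ N → (N \ D).card = m →
      ∀ h : ℝ, (∀ a : Fin n, Act D a → h ≤ slack D a) →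
        (prodBernoulli (KD D)).real ({ω : Set (Sym2 (Fin n)) | ∃ e ∈ Fall, e ∈ ω} ∩ MU) -
            (prodBernoulli (KD D)).real ({ω : Set (Sym2 (Fin n)) | ∃ e ∈ Fall, e ∈ ω} ∩ MX) ≥
          (prodBernoulli (KD D)).real {ω : Set (Sym2 (Fin n)) | ∃ e ∈ Fall, e ∈ ω} * h := by
    intro m
    induction m using Nat.strong_induction_on with
    | _ m ih =>
      intro D hDN hcard h hh
      by_cases hact : ∃ a ∈ A, a ≠ b ∧ ∃ v ∈ N, v ∉ D ∧ (K s(v, a) : ℝ) ≠ 0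
      · -- an active stage: peel the finger given by FQ♯
        obtain ⟨f, hfN, hfD, -, hFQ⟩ := HFQ D hDN hact
        set D' : Finset (Fin n) := insert f D with hD'
        have hD'N : D' ⊆ N := Finset.insert_subset hfN hDN
        have hcard' : (N \ D').card < m := by
          rw [← hcard, hD']
          apply Finset.card_lt_card
          refine ⟨Finset.sdiff_subset_sdiff le_rfl (Finset.subset_insert f D), fun hsub => ?_⟩
          have hf : f ∈ N \ D := Finset.mem_sdiff.2 ⟨hfN, hfD⟩
          have := hsub hf
          rw [Finset.mem_sdiff] at this
          exact this.2 (Finset.mem_insert_self f D)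
        -- the slack `h'` of the next stage
        have hex : ∃ h' : ℝ, (∀ a : Fin n, Act D' a → h' ≤ slack D' a) ∧
            ((∃ a : Fin n, Act D' a ∧ h' = slack D' a) ∨ ((¬ ∃ a : Fin n, Act D' a) ∧ h' = h)) := by
          by_cases hact' : ∃ a : Fin n, Act D' a
          · set T : Finset (Fin n) := Finset.univ.filter (fun a => Act D' a) with hT
            have hTne : (T.image (slack D')).Nonempty := by
              obtain ⟨a, ha⟩ := hact'
              exact ⟨slack D' a, Finset.mem_image.2 ⟨a, Finset.mem_filter.2 ⟨Finset.mem_univ a, ha⟩, rfl⟩⟩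
            refine ⟨(T.image (slack D')).min' hTne, ?_, Or.inl ?_⟩
            · intro a ha
              exact Finset.min'_le _ _ (Finset.mem_image.2 ⟨a, Finset.mem_filter.2 ⟨Finset.mem_univ a, ha⟩, rfl⟩)
            · obtain ⟨a, ha, heq⟩ := Finset.mem_image.1 (Finset.min'_mem _ hTne)
              exact ⟨a, (Finset.mem_filter.1 ha).2, heq.symm⟩
          · exact ⟨h, fun a ha => (hact' ⟨a, ha⟩).elim, Or.inr ⟨hact', rfl⟩⟩
        obtain ⟨h', hh'le, hh'eq⟩ := hex
        -- the induction hypothesis at stage `D'`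
        have hIH := ih _ hcard' D' hD'N rfl h' hh'le
        -- FQ♯ at stage `D` for the finger `f`
        have hQ := hFQ h h' (fun a ha hab hav => hh a ⟨ha, hab, hav⟩)
          ⟨fun a ha hab hav => hh'le a ⟨ha, hab, hav⟩,
           hh'eq.elim (fun ⟨a, ha, heq⟩ => Or.inl ⟨a, ha.1, ha.2.1, ha.2.2, heq⟩)
             (fun ⟨hno, heq⟩ => Or.inr ⟨fun ⟨a, ha, hab, hav⟩ => hno ⟨a, ha, hab, hav⟩, heq⟩)⟩
        -- the killed weighting of the step is the next stage
        have hpin : pinW (KD D) (↑(A.image (fun a : Fin n => s(f, a))) : Set (Sym2 (Fin n))) (∅ : Set (Sym2 (Fin n))) = KD D' :=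
          killStage_pinW_eq K A D f
        rw [← hpin] at hIH
        have hstep := linearCert_split_step (KD D) N (A.image (fun a : Fin n => s(f, a))) Fall d b h h' hQ hIH
        -- `F_f ∪ F_all = F_all`
        have hsubF : A.image (fun a : Fin n => s(f, a)) ⊆ Fall := by
          intro e he
          obtain ⟨a, ha, rfl⟩ := Finset.mem_image.1 he
          exact Finset.mem_image.2 ⟨(f, a), Finset.mem_product.2 ⟨hfN, ha⟩, rfl⟩
        rw [Finset.union_eq_right.2 hsubF] at hstep
        exact hstep
      · -- no active contact: `R` is null at this stage
        have hnull : (prodBernoulli (KD D)).real {ω : Set (Sym2 (Fin n)) | ∃ e ∈ Fall, e ∈ ω} = 0 := by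
          have hsub : ({ω : Set (Sym2 (Fin n)) | ∃ e ∈ Fall, e ∈ ω} : Set (BondConfig (Fin n))) ⊆
              ⋃ e ∈ Fall, {ω : Set (Sym2 (Fin n)) | e ∈ ω} := by
            intro ω ⟨e, he, heω⟩
            exact Set.mem_biUnion he heω
          have hzero : ∀ e ∈ Fall, (prodBernoulli (KD D)).real {ω : Set (Sym2 (Fin n)) | e ∈ ω} = 0 := by
            intro e he
            rw [prodBernoulli_real_setOf_mem]
            obtain ⟨⟨v, a⟩, hva, rfl⟩ := Finset.mem_image.1 he
            obtain ⟨hv, ha⟩ := Finset.mem_product.1 hva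
            by_cases hkill : ∃ v' ∈ D, ∃ a' ∈ A, s(v, a) = s(v', a')
            · have : KD D s(v, a) = 0 := by simp only [KD, hkill, if_true]
              rw [this]; rfl
            · have hKD : KD D s(v, a) = K s(v, a) := by simp only [KD, hkill, if_false]
              rw [hKD]
              have hvD : v ∉ D := fun hvD => hkill ⟨v, hvD, a, ha, rfl⟩
              by_cases hab : a = b
              · subst hab; exact hnb v hv
              · by_contra hne
                exact hact ⟨a, ha, hab, v, hv, hvD, hne⟩
          refine le_antisymm ?_ measureReal_nonneg
          calc (prodBernoulli (KD D)).real {ω : Set (Sym2 (Fin n)) | ∃ e ∈ Fall, e ∈ ω}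
              ≤ (prodBernoulli (KD D)).real (⋃ e ∈ Fall, {ω : Set (Sym2 (Fin n)) | e ∈ ω}) :=
                measureReal_mono hsub (measure_ne_top _ _)
            _ ≤ ∑ e ∈ Fall, (prodBernoulli (KD D)).real {ω : Set (Sym2 (Fin n)) | e ∈ ω} :=
                measureReal_biUnion_finset_le _ _
            _ = 0 := Finset.sum_eq_zero hzero
        have h1 : (prodBernoulli (KD D)).real ({ω : Set (Sym2 (Fin n)) | ∃ e ∈ Fall, e ∈ ω} ∩ MU) = 0 :=
          le_antisymm ((measureReal_mono Set.inter_subset_left (measure_ne_top _ _)).trans hnull.le) measureReal_nonneg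
        have h2 : (prodBernoulli (KD D)).real ({ω : Set (Sym2 (Fin n)) | ∃ e ∈ Fall, e ∈ ω} ∩ MX) = 0 :=
          le_antisymm ((measureReal_mono Set.inter_subset_left (measure_ne_top _ _)).trans hnull.le) measureReal_nonneg
        rw [h1, h2, hnull]
        simp
  -- stage `∅` is `K`
  have hK0 : KD ∅ = K := by
    funext e
    have : ¬ ∃ v ∈ (∅ : Finset (Fin n)), ∃ a' ∈ A, e = s(v, a') := by
      rintro ⟨v, hv, -⟩; exact Finset.notMem_empty v hv
    simp only [KD, this, if_false]
  have h0 := main _ ∅ (Finset.empty_subset N) rfl 0 (by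
    rintro a ⟨ha, -, -⟩
    show (0 : ℝ) ≤ slack ∅ a
    simp only [slack, hK0]
    linarith [hle a ha])
  rw [hK0, mul_zero] at h0
  -- conclude by the set form of the stub
  refine fingerML3_of_setForm K A N d b hNA ?_
  rw [fingerContact_R_eq N A, ← hFall, Set.inter_assoc, Set.inter_assoc]
  linarith

end FQsharpReduction

end

end Summit.CriticalPhenomena.PercolationContinuityZ3.Theorems
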